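import Summits.RiemannHypothesis.RiemannHypothesis.Theorems.WeilTwoPrimeDeflC83XBase
import Summits.RiemannHypothesis.RiemannHypothesis.Theorems.WeilTwoPrimeDeflC83XDataPE30
import Summits.RiemannHypothesis.RiemannHypothesis.Theorems.WeilTwoPrimeDeflC83XDataDnSE6
import Literature.NumberTheory.LFunctions.WeilBlockRowsPZ
import Literature.NumberTheory.LFunctions.WeilBlockRowsFast
import HarnessLib

/-!
# Deflated two-prime certificate C83X: dominance of rows 20, 21, 22, 23, 24, 25, 26, 27 of `R = S''_even(κ') − UᵀU` (rescaled factored data, 8 rows packed)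

`WeilCert.checkDomRowPZ` with the materialized augmented block, the COLUMN-RESCALED factored inverse `weilCertDeflC83XDnSE/weilCertDeflC83XLsSE` and the Bessel block, by `decide +kernel` row by row via the fast row `checkDomRowF`. Reason (prover B g9, kernel-cost lever, farm-measured 2026-08-23): Lean hashes a `Nat` literal by its low 64 bits and 5 400 of the 9 316 entries of the original factored inverse are divisible by `2^64`, so every kernel cache holding them degenerates (one dominance row ≈ 230 s); the column-rescaled rows (`v₂ ≤ 7`, pairwise distinct low words) traverse in seconds and the dominance rows pack ~10 per file. Pure proof file.
-/

set_option linter.dupNamespace false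
set_option Elab.async false

noncomputable section

namespace Summit.RiemannHypothesis.RiemannHypothesis.Theorems.EvenWinsBeyondArch

open Literature.NumberTheory.LFunctions

set_option maxHeartbeats 0 in
/-- Kernel check of the dominance of row 20 of `R` (even block, certificate C83X; rescaled factorisation `DnS/LsS`). [folklore] -/
theorem checkDomRowFS0_20_weilCertDeflC83X :
    weilCertDeflC83XBase.checkDomRowF weilCertDeflC83XPmE weilCertDeflC83XDnSE weilCertDeflC83XLsSE weilCertDeflC83XHpE weilCertDeflC83XKappa' 0 20 = true := by
  decide +kernel

/-- Dominance of row 20 of `R` (even block, rescaled factored data), from the fast row. [folklore] -/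
theorem checkDomRowPZS0_20_weilCertDeflC83X :
    weilCertDeflC83XBase.checkDomRowPZ weilCertDeflC83XPmE weilCertDeflC83XDnSE weilCertDeflC83XLsSE weilCertDeflC83XHpE weilCertDeflC83XKappa' 0 20 = true :=
  WeilCert.checkDomRowPZ_of_F (by decide) checkDomRowFS0_20_weilCertDeflC83X

set_option maxHeartbeats 0 in
/-- Kernel check of the dominance of row 21 of `R` (even block, certificate C83X; rescaled factorisation `DnS/LsS`). [folklore] -/
theorem checkDomRowFS0_21_weilCertDeflC83X :
    weilCertDeflC83XBase.checkDomRowF weilCertDeflC83XPmE weilCertDeflC83XDnSE weilCertDeflC83XLsSE weilCertDeflC83XHpE weilCertDeflC83XKappa' 0 21 = true := by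
  decide +kernel

/-- Dominance of row 21 of `R` (even block, rescaled factored data), from the fast row. [folklore] -/
theorem checkDomRowPZS0_21_weilCertDeflC83X :
    weilCertDeflC83XBase.checkDomRowPZ weilCertDeflC83XPmE weilCertDeflC83XDnSE weilCertDeflC83XLsSE weilCertDeflC83XHpE weilCertDeflC83XKappa' 0 21 = true :=
  WeilCert.checkDomRowPZ_of_F (by decide) checkDomRowFS0_21_weilCertDeflC83X

set_option maxHeartbeats 0 in
/-- Kernel check of the dominance of row 22 of `R` (even block, certificate C83X; rescaled factorisation `DnS/LsS`). [folklore] -/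
theorem checkDomRowFS0_22_weilCertDeflC83X :
    weilCertDeflC83XBase.checkDomRowF weilCertDeflC83XPmE weilCertDeflC83XDnSE weilCertDeflC83XLsSE weilCertDeflC83XHpE weilCertDeflC83XKappa' 0 22 = true := by
  decide +kernel

/-- Dominance of row 22 of `R` (even block, rescaled factored data), from the fast row. [folklore] -/
theorem checkDomRowPZS0_22_weilCertDeflC83X :
    weilCertDeflC83XBase.checkDomRowPZ weilCertDeflC83XPmE weilCertDeflC83XDnSE weilCertDeflC83XLsSE weilCertDeflC83XHpE weilCertDeflC83XKappa' 0 22 = true :=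
  WeilCert.checkDomRowPZ_of_F (by decide) checkDomRowFS0_22_weilCertDeflC83X

set_option maxHeartbeats 0 in
/-- Kernel check of the dominance of row 23 of `R` (even block, certificate C83X; rescaled factorisation `DnS/LsS`). [folklore] -/
theorem checkDomRowFS0_23_weilCertDeflC83X :
    weilCertDeflC83XBase.checkDomRowF weilCertDeflC83XPmE weilCertDeflC83XDnSE weilCertDeflC83XLsSE weilCertDeflC83XHpE weilCertDeflC83XKappa' 0 23 = true := by
  decide +kernel

/-- Dominance of row 23 of `R` (even block, rescaled factored data), from the fast row. [folklore] -/
theorem checkDomRowPZS0_23_weilCertDeflC83X :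
    weilCertDeflC83XBase.checkDomRowPZ weilCertDeflC83XPmE weilCertDeflC83XDnSE weilCertDeflC83XLsSE weilCertDeflC83XHpE weilCertDeflC83XKappa' 0 23 = true :=
  WeilCert.checkDomRowPZ_of_F (by decide) checkDomRowFS0_23_weilCertDeflC83X

set_option maxHeartbeats 0 in
/-- Kernel check of the dominance of row 24 of `R` (even block, certificate C83X; rescaled factorisation `DnS/LsS`). [folklore] -/
theorem checkDomRowFS0_24_weilCertDeflC83X :
    weilCertDeflC83XBase.checkDomRowF weilCertDeflC83XPmE weilCertDeflC83XDnSE weilCertDeflC83XLsSE weilCertDeflC83XHpE weilCertDeflC83XKappa' 0 24 = true := by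
  decide +kernel

/-- Dominance of row 24 of `R` (even block, rescaled factored data), from the fast row. [folklore] -/
theorem checkDomRowPZS0_24_weilCertDeflC83X :
    weilCertDeflC83XBase.checkDomRowPZ weilCertDeflC83XPmE weilCertDeflC83XDnSE weilCertDeflC83XLsSE weilCertDeflC83XHpE weilCertDeflC83XKappa' 0 24 = true :=
  WeilCert.checkDomRowPZ_of_F (by decide) checkDomRowFS0_24_weilCertDeflC83X

set_option maxHeartbeats 0 in
/-- Kernel check of the dominance of row 25 of `R` (even block, certificate C83X; rescaled factorisation `DnS/LsS`). [folklore] -/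
theorem checkDomRowFS0_25_weilCertDeflC83X :
    weilCertDeflC83XBase.checkDomRowF weilCertDeflC83XPmE weilCertDeflC83XDnSE weilCertDeflC83XLsSE weilCertDeflC83XHpE weilCertDeflC83XKappa' 0 25 = true := by
  decide +kernel

/-- Dominance of row 25 of `R` (even block, rescaled factored data), from the fast row. [folklore] -/
theorem checkDomRowPZS0_25_weilCertDeflC83X :
    weilCertDeflC83XBase.checkDomRowPZ weilCertDeflC83XPmE weilCertDeflC83XDnSE weilCertDeflC83XLsSE weilCertDeflC83XHpE weilCertDeflC83XKappa' 0 25 = true :=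
  WeilCert.checkDomRowPZ_of_F (by decide) checkDomRowFS0_25_weilCertDeflC83X

set_option maxHeartbeats 0 in
/-- Kernel check of the dominance of row 26 of `R` (even block, certificate C83X; rescaled factorisation `DnS/LsS`). [folklore] -/
theorem checkDomRowFS0_26_weilCertDeflC83X :
    weilCertDeflC83XBase.checkDomRowF weilCertDeflC83XPmE weilCertDeflC83XDnSE weilCertDeflC83XLsSE weilCertDeflC83XHpE weilCertDeflC83XKappa' 0 26 = true := by
  decide +kernel

/-- Dominance of row 26 of `R` (even block, rescaled factored data), from the fast row. [folklore] -/
theorem checkDomRowPZS0_26_weilCertDeflC83X :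
    weilCertDeflC83XBase.checkDomRowPZ weilCertDeflC83XPmE weilCertDeflC83XDnSE weilCertDeflC83XLsSE weilCertDeflC83XHpE weilCertDeflC83XKappa' 0 26 = true :=
  WeilCert.checkDomRowPZ_of_F (by decide) checkDomRowFS0_26_weilCertDeflC83X

set_option maxHeartbeats 0 in
/-- Kernel check of the dominance of row 27 of `R` (even block, certificate C83X; rescaled factorisation `DnS/LsS`). [folklore] -/
theorem checkDomRowFS0_27_weilCertDeflC83X :
    weilCertDeflC83XBase.checkDomRowF weilCertDeflC83XPmE weilCertDeflC83XDnSE weilCertDeflC83XLsSE weilCertDeflC83XHpE weilCertDeflC83XKappa' 0 27 = true := by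
  decide +kernel

/-- Dominance of row 27 of `R` (even block, rescaled factored data), from the fast row. [folklore] -/
theorem checkDomRowPZS0_27_weilCertDeflC83X :
    weilCertDeflC83XBase.checkDomRowPZ weilCertDeflC83XPmE weilCertDeflC83XDnSE weilCertDeflC83XLsSE weilCertDeflC83XHpE weilCertDeflC83XKappa' 0 27 = true :=
  WeilCert.checkDomRowPZ_of_F (by decide) checkDomRowFS0_27_weilCertDeflC83X

end Summit.RiemannHypothesis.RiemannHypothesis.Theorems.EvenWinsBeyondArch
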